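import Summits.KontsevichZagierPeriods.KontsevichZagierPeriods.Theses.HurwitzMicroSectors
import Summits.KontsevichZagierPeriods.KontsevichZagierPeriods.Theorems.HurwitzMicroSectorsNormalFormPrinciplePiBoxTransfer
import Summits.KontsevichZagierPeriods.KontsevichZagierPeriods.Theorems.HurwitzMicroSectorsNormalFormPrincipleVariants2283

/-! TTRL-lite variant V2304 of stmt-KontsevichZagierPeriods-3869

Variant V2304 = `stub_boxRigidity` (the leaf `BoxRigidity` of `NormalFormPrinciple`: two representations
on open unit boxes with integrands of KZ's rational shape `p/q` over `ℚ` and equal values are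
KZ-equivalent) with BOTH dimensions frozen, `fix m := 6; fix m' := 3`. Verdict of the attempt seat:
**open** — this file is the exact-strength certificate, not a proof of the variant. For every `K` let
`BoxVanishing K` say that a box-rational representation of dimension `K` and value `0` is a relation.
First the general fact that settles every two-sided freeze of this stub at once: two frozen pairs with
the same larger dimension are the SAME statement (`boxRigidityPair_congr_max`, from the tree's
`boxRigidityPair_iff_boxVanishingDim`: a frozen pair `(K, m₀)` is exactly `BoxVanishing (max K m₀)` —
compare with the zero representation one way, pad by unit intervals and subtract on the common box the
other way). Hence `V2304 ⟺ BoxVanishing 6 ⟺ BoxRigidity for all m, m' ≤ 6 ⟺ V2227 (pair (2,6)) ⟺ the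
swapped pair (3,6)` (`stub_boxRigidity_var2304_iff_boxVanishing_six`, `…_iff_le_six`, `…_iff_var2227`,
`…_iff_swap`), and V2304 gives `BoxVanishing j` for every `j ≤ 6`
(`boxVanishing_le_six_of_stub_boxRigidity_var2304`). `BoxVanishing 1` is a theorem of the tree
(`boxRigidity_of_le_one`, Baker); from dimension `2` on it is open: `BoxVanishing 5` (a consequence of
V2304) contains "for `a b : ℚ`, `a + b·ζ(5) = 0 ⇒ [a + b/(1 − x₁⋯x₅)]_{(0,1)⁵}` is a relation", provable
today only through the irrationality of `ζ(5)` (open) or an explicit chain of moves (none can exist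
unless `ζ(5) ∈ ℚ`); `BoxVanishing 2` contains the same dichotomy for Catalan's `G = ∫∫ dx dy/(1+x²y²)`,
`BoxVanishing 3` the case split `ζ(3) ∈ ℚ + ℚπ²`. Conversely `KontsevichZagierPeriods → parent → V2304`
(`stub_boxRigidity_var2304_of_statement`), so a refutation of the variant would refute the Summit
(Conjecture 1 for the tree's calculus); the tree has no invariant of `KZ.relations` finer than `KZ.eval`.
Source: M. Kontsevich, D. Zagier, *Periods* (2001), §1.2 Conjecture 1 and rules 1)–3). Pure proof file,
no definitions. -/

-- `Summit.<Summit>.<Problem>` is the tree's mandated summit-side namespace (CONVENTIONS §2); for this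
-- single-conjunct summit the two coincide, so the duplicate is deliberate.
set_option linter.dupNamespace false

noncomputable section

namespace Summit.KontsevichZagierPeriods.KontsevichZagierPeriods.Theorems

open MeasureTheory Set
open Literature.NumberTheory.Transcendental Literature.NumberTheory.Transcendental.KZ
open Summit.KontsevichZagierPeriods.KontsevichZagierPeriods.Theses.HurwitzMicroSectors
open Summit.KontsevichZagierPeriods.HurwitzMicroSectors.NormalFormPrinciple.PiBox

/-! ## Two frozen pairs with the same larger dimension are the same statement -/

/-- **`BoxRigidity(K, m₀) ⟺ BoxRigidity(K', m₀')` whenever `max K m₀ = max K' m₀'`**: both are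
`BoxVanishing` at the common larger dimension (`boxRigidityPair_iff_boxVanishingDim`). This settles every
programmatic move `fix_nat:m=a; fix_nat:m'=b` of `stub_boxRigidity` relative to any sibling with the same
`max a b`. [cite: KontsevichZagier2001, §1.2 Conjecture 1] -/
theorem boxRigidityPair_congr_max {K m₀ K' m₀' : ℕ} (h : max K m₀ = max K' m₀') :
    (∀ (N : IntegralRep K) (N' : IntegralRep m₀),
      N.domain = {x | ∀ i, x i ∈ Set.Ioo (0:ℝ) 1} → N.IsRational →
      N'.domain = {x | ∀ i, x i ∈ Set.Ioo (0:ℝ) 1} → N'.IsRational →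
      N.value = N'.value → Equivalent N N') ↔
    (∀ (N : IntegralRep K') (N' : IntegralRep m₀'),
      N.domain = {x | ∀ i, x i ∈ Set.Ioo (0:ℝ) 1} → N.IsRational →
      N'.domain = {x | ∀ i, x i ∈ Set.Ioo (0:ℝ) 1} → N'.IsRational →
      N.value = N'.value → Equivalent N N') := by
  rw [boxRigidityPair_iff_boxVanishingDim K m₀, boxRigidityPair_iff_boxVanishingDim K' m₀']
  obtain ⟨n, hn, hn'⟩ : ∃ n, max K m₀ = n ∧ max K' m₀' = n := ⟨_, h, rfl⟩
  subst hn
  rw [hn']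

/-! ## The variant V2304 itself: exactly `BoxVanishing 6` -/

/-- **V2304 ⟺ `BoxVanishing 6`**: a box-rational representation on the `6`-box of value `0` is a
relation (instance `(K, m₀) = (6, 3)` of `boxRigidityPair_iff_boxVanishingDim`, `max 6 3 = 6`).
[cite: KontsevichZagier2001, §1.2 Conjecture 1] -/
theorem stub_boxRigidity_var2304_iff_boxVanishing_six :
    (∀ (N : IntegralRep 6) (N' : IntegralRep 3), N.domain = {x | ∀ i, x i ∈ Set.Ioo (0:ℝ) 1} → N.IsRational → N'.domain = {x | ∀ i, x i ∈ Set.Ioo (0:ℝ) 1} → N'.IsRational → N.value = N'.value → Equivalent N N') ↔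
    (∀ (M : IntegralRep 6), M.domain = {x | ∀ i, x i ∈ Set.Ioo (0:ℝ) 1} →
      M.IsRational → M.value = 0 → of M ∈ relations) :=
  boxRigidityPair_iff_boxVanishingDim 6 3

/-- **V2304 ⟺ the two-sided bounded leaf `BoxRigidity(m, m' ≤ 6)`** (the honest strength of the
variant: Conjecture 1 for all pairs of rational integrands on the open unit boxes of dimension at most
`6` — among these periods `π²`, `π⁴`, `π⁶`, `ζ(3)`, `ζ(5)`, `ζ(3)²`, Catalan's `G` and every multiple zeta
value of weight `≤ 6`; freezing `m' := 3` rather than `6` loses nothing, by padding).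
[cite: KontsevichZagier2001, §1.2 Conjecture 1] -/
theorem stub_boxRigidity_var2304_iff_le_six :
    (∀ (N : IntegralRep 6) (N' : IntegralRep 3), N.domain = {x | ∀ i, x i ∈ Set.Ioo (0:ℝ) 1} → N.IsRational → N'.domain = {x | ∀ i, x i ∈ Set.Ioo (0:ℝ) 1} → N'.IsRational → N.value = N'.value → Equivalent N N') ↔
    (∀ (m m' : ℕ) (N : IntegralRep m) (N' : IntegralRep m'), m ≤ 6 → m' ≤ 6 →
      N.domain = {x | ∀ i, x i ∈ Set.Ioo (0:ℝ) 1} → N.IsRational →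
      N'.domain = {x | ∀ i, x i ∈ Set.Ioo (0:ℝ) 1} → N'.IsRational →
      N.value = N'.value → Equivalent N N') :=
  boxRigidityPair_iff_boxRigidityLe 6 3

/-- **V2304 ⟺ the sibling V2227** (`fix_nat:m=2; fix_nat:m'=6`): both pairs have larger dimension `6`
(`boxRigidityPair_congr_max`). [cite: KontsevichZagier2001, §1.2 Conjecture 1] -/
theorem stub_boxRigidity_var2304_iff_var2227 :
    (∀ (N : IntegralRep 6) (N' : IntegralRep 3), N.domain = {x | ∀ i, x i ∈ Set.Ioo (0:ℝ) 1} → N.IsRational → N'.domain = {x | ∀ i, x i ∈ Set.Ioo (0:ℝ) 1} → N'.IsRational → N.value = N'.value → Equivalent N N') ↔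
    (∀ (N : IntegralRep 2) (N' : IntegralRep 6), N.domain = {x | ∀ i, x i ∈ Set.Ioo (0:ℝ) 1} →
      N.IsRational → N'.domain = {x | ∀ i, x i ∈ Set.Ioo (0:ℝ) 1} → N'.IsRational →
      N.value = N'.value → Equivalent N N') :=
  boxRigidityPair_congr_max (by norm_num)

/-- **V2304 is the same statement as the swapped pair `(3, 6)`** (again `boxRigidityPair_congr_max`;
equivalently, symmetry of `Equivalent`). [cite: KontsevichZagier2001, §1.2 Conjecture 1] -/
theorem stub_boxRigidity_var2304_iff_swap :
    (∀ (N : IntegralRep 6) (N' : IntegralRep 3), N.domain = {x | ∀ i, x i ∈ Set.Ioo (0:ℝ) 1} → N.IsRational → N'.domain = {x | ∀ i, x i ∈ Set.Ioo (0:ℝ) 1} → N'.IsRational → N.value = N'.value → Equivalent N N') ↔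
    (∀ (N : IntegralRep 3) (N' : IntegralRep 6), N.domain = {x | ∀ i, x i ∈ Set.Ioo (0:ℝ) 1} →
      N.IsRational → N'.domain = {x | ∀ i, x i ∈ Set.Ioo (0:ℝ) 1} → N'.IsRational →
      N.value = N'.value → Equivalent N N') :=
  boxRigidityPair_congr_max (by norm_num)

/-! ## Consequences downward, and the variant from above -/

/-- **V2304 ⇒ `BoxVanishing` in every dimension `j ≤ 6`**: compare a vanishing box-rational
representation on `(0,1)ʲ` with the zero representation on the same box, via the bounded leaf
(`stub_boxRigidity_var2304_iff_le_six`); in particular the dimension-`5` statement containing the `ζ(5)`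
dichotomy and the dimension-`2` one containing Catalan's. [cite: KontsevichZagier2001, §1.2 Conjecture 1] -/
theorem boxVanishing_le_six_of_stub_boxRigidity_var2304
    (h : ∀ (N : IntegralRep 6) (N' : IntegralRep 3), N.domain = {x | ∀ i, x i ∈ Set.Ioo (0:ℝ) 1} → N.IsRational → N'.domain = {x | ∀ i, x i ∈ Set.Ioo (0:ℝ) 1} → N'.IsRational → N.value = N'.value → Equivalent N N')
    {j : ℕ} (hj : j ≤ 6) (N : IntegralRep j) (hNd : N.domain = {x | ∀ i, x i ∈ Set.Ioo (0:ℝ) 1})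
    (hNr : N.IsRational) (hv : N.value = 0) : of N ∈ relations := by
  have hpair : ∀ (N : IntegralRep j) (N' : IntegralRep j), N.domain = {x | ∀ i, x i ∈ Set.Ioo (0:ℝ) 1} →
      N.IsRational → N'.domain = {x | ∀ i, x i ∈ Set.Ioo (0:ℝ) 1} → N'.IsRational →
      N.value = N'.value → Equivalent N N' :=
    fun N N' => stub_boxRigidity_var2304_iff_le_six.1 h j j N N' hj hj
  have hvan := (boxRigidityPair_iff_boxVanishingDim j j).1 hpair
  rw [max_self] at hvan
  exact hvan N hNd hNr hv

/-- **`BoxVanishing 6` alone already proves V2304** (the honest residual of the variant: whoever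
settles Conjecture 1 for vanishing box-rational periods of dimension `6` settles V2304, and conversely).
[cite: KontsevichZagier2001, §1.2 Conjecture 1] -/
theorem stub_boxRigidity_var2304_of_boxVanishing_six
    (hvan : ∀ (M : IntegralRep 6), M.domain = {x | ∀ i, x i ∈ Set.Ioo (0:ℝ) 1} → M.IsRational →
      M.value = 0 → of M ∈ relations) :
    ∀ (N : IntegralRep 6) (N' : IntegralRep 3), N.domain = {x | ∀ i, x i ∈ Set.Ioo (0:ℝ) 1} → N.IsRational → N'.domain = {x | ∀ i, x i ∈ Set.Ioo (0:ℝ) 1} → N'.IsRational → N.value = N'.value → Equivalent N N' :=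
  stub_boxRigidity_var2304_iff_boxVanishing_six.2 hvan

/-- **The parent leaf ⇒ V2304** (specialisation `m := 6`, `m' := 3`; the converse is not claimed —
the parent is `BoxVanishing` in ALL dimensions). [cite: KontsevichZagier2001, §1.2 Conjecture 1] -/
theorem stub_boxRigidity_var2304_of_parent
    (h : ∀ (m m' : ℕ) (N : IntegralRep m) (N' : IntegralRep m'), N.domain = {x | ∀ i, x i ∈ Set.Ioo (0:ℝ) 1} → N.IsRational → N'.domain = {x | ∀ i, x i ∈ Set.Ioo (0:ℝ) 1} → N'.IsRational → N.value = N'.value → Equivalent N N') :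
    ∀ (N : IntegralRep 6) (N' : IntegralRep 3), N.domain = {x | ∀ i, x i ∈ Set.Ioo (0:ℝ) 1} → N.IsRational → N'.domain = {x | ∀ i, x i ∈ Set.Ioo (0:ℝ) 1} → N'.IsRational → N.value = N'.value → Equivalent N N' :=
  h 6 3

/-- **`KontsevichZagierPeriods ⇒ V2304`**: the variant is a special case of Conjecture 1 for the
tree's calculus (`leaves_of_statement`) — so a refutation of the variant would refute the Summit.
[cite: KontsevichZagier2001, §1.2 Conjecture 1] -/
theorem stub_boxRigidity_var2304_of_statement (h : _root_.KontsevichZagierPeriods) :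
    ∀ (N : IntegralRep 6) (N' : IntegralRep 3), N.domain = {x | ∀ i, x i ∈ Set.Ioo (0:ℝ) 1} → N.IsRational → N'.domain = {x | ∀ i, x i ∈ Set.Ioo (0:ℝ) 1} → N'.IsRational → N.value = N'.value → Equivalent N N' :=
  (leaves_of_statement h).1 6 3

end Summit.KontsevichZagierPeriods.KontsevichZagierPeriods.Theorems

end
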